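import Summits.QuantumFields.QCD.Theses.MultibosonBridge
import Literature.Analysis.SpecialFunctions.ComplexGaussianDeterminant
import Literature.MathematicalPhysics.QuantumFieldTheory.Multiboson
import Literature.Barriers.QuantumFields.WilsonDeterminantSign

/-!
# Route `MultibosonBridge` (sub QCD) — support item `MultibosonGaussian` (stmt-QuantumFields-9602), PROVED

Lüscher's «one root = one local boson field»: for non-real `z`,
`∫_{ℂᴺ} exp(−Σᵢ |((Γ₅D_W(U,μ) − z)v)ᵢ|²) dv = πᴺ / |det(Γ₅D_W(U,μ) − z)|²`.
An INSTANTIATION of the tree's discharged complex Gaussian integral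
`Literature.Analysis.SpecialFunctions.complexGaussianIntegral_normSq_of complexGaussianIntegral_posDef_holds`
(Altland–Simons (3.17) at `A = BᴴB`) at `B := Γ₅D_W − z·1`, invertible because `Γ₅D_W` is Hermitian
(`WilsonDeterminant.isHermitian_hermitianWilsonDirac`, `fundamentalRep_mem_unitaryGroup`) and `Im z ≠ 0`
(`det_sub_smul_one_ne_zero_of_isHermitian`).  The grounder g21-18 recorded this instantiation certificate on
2026-08-15; landed here.

HONEST FRAMING: support bookkeeping; the route's cruxes and the summit conjunct `QCD` are untouched.
[cite: Luscher1994, §3 (3.7)–(3.9); AltlandSimons2010, §3.2 eq. (3.17)]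
-/

set_option autoImplicit false

namespace Summit.QuantumFields.QCD.Theorems.MultibosonBridge

open Literature.MathematicalPhysics.QuantumFieldTheory
open Literature.MathematicalPhysics.QuantumLattice
open Literature.Probability.LatticeModels (TorusSite)
open Literature.Analysis.SpecialFunctions

/-- The route's support item `MultibosonGaussian` (stmt-QuantumFields-9602) BY NAME.
[cite: Luscher1994, §3 (3.7)–(3.9); AltlandSimons2010, §3.2 eq. (3.17)] -/
theorem multibosonGaussian_proof :
    Summit.QuantumFields.QCD.Theses.MultibosonBridge.MultibosonGaussian := by
  intro S _ U μ z hz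
  have hH : (spinorLift gammaFive * wilsonDirac (fundamentalRep (Fin 3)) U μ 1 :
      Matrix (TorusSite 4 S × Fin 3 × Fin 4) (TorusSite 4 S × Fin 3 × Fin 4) ℂ).IsHermitian :=
    Literature.Barriers.QuantumFields.WilsonDeterminant.isHermitian_hermitianWilsonDirac
      (fundamentalRep (Fin 3)) fundamentalRep_mem_unitaryGroup U μ 1
  exact complexGaussianIntegral_normSq_of complexGaussianIntegral_posDef_holds _ _
    (det_sub_smul_one_ne_zero_of_isHermitian hH hz)

end Summit.QuantumFields.QCD.Theorems.MultibosonBridge
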